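import Summits.QuantumFields.YangMills.Theorems.FluctuationComparisonRegPrIntLS2BetaCoarseCurlLocal
import HarnessLib

/-!
# S2β · (CURL-AVG, LETTER M-1′) THE ROWS IN SHAPE: the one-step coarse-curl bound (✓E, local edition) RE-READ IN THE LOWER-LEFT CONVENTION of px16 g23's composed
# dilution kernel — `ρ_{i+1}(y′) ≤ |I|⁻¹·Σ_{a ∈ I × L × L} ρ_i(blockSite y′ r_a + s_a e_μ + t_a e_ν) + src_{i+1}(y′)` — for the whole descended tower `U_{i+1} = Ū(U_i)`, `X_{i+1} = ψ_{U_i}(X_i)`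

Cell `ym3-torus` (YM ladder rung R3 = continuum `SU(2)` Yang–Mills on the three-torus at fixed lattice data — a RUNG: NOT d = 4, NOT infinite volume, NOT a mass gap,
NOT Clay).  Width seat `ym3-torus-px13` (gen 27); crux `stmt-QuantumFields-20520`, LINE g18-1 S2β, pairing lane; (SCT′-c)₁ road of record = CURL-AVG (✓A–F, px13 g26) ∘ px16 g23's
`exists_composedKernel` (K0)–(K5) ∘ ✓DOCK `dock_of_kernel` (p831065) ∘ (★) (p830704).  (K5)'s ROW HYPOTHESIS reads (px16 g23 18:45:05Z, verbatim):
`∀ i, i < r → ∀ y' : Site P (i + 1), ρ (i + 1) y' ≤ (Fintype.card (Idx P) : ℝ)⁻¹ * ∑ a ∈ (Finset.univ : Finset (Idx P)) ×ˢ (Finset.range P.L ×ˢ Finset.range P.L),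
ρ i (shiftN (shiftN (Site.blockSite y' a.1.1) μ a.2.1) ν a.2.2) + src (i + 1) y'` — fine plaquettes indexed by their LOWER-LEFT corner `x_a = blockSite y′ r_a + s_a e_μ + t_a e_ν` and read by
the word `[μ⁺, ν⁺, μ̄, ν̄]` from `x_a`, whereas ✓E `norm_curl_chartRead_le_local(_SU2)` (= B2 ✓`norm_curl_covLinAvgR0_le` + C + locality) indexes the same plaquettes by `(i, s, t)` with the
word `[ν⁺, μ̄, ν̄, μ⁺]` read from the LOWER-RIGHT corner `x_a + e_μ`.  THIS FILE is the one-edge conjugation between the two readings and the re-indexing, for one step and for the tower.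
`--kind proof --supports stmt-QuantumFields-20520 --as helper`, count-neutral, DEFINITION-FREE; generic `P : Params` (standing range), `SU(N)` for the algebra, `SU(2)` for the rows.

WHAT IS PROVED (sorry-free).
§1 ★`holAt_walk_plaq_eq_prod` (`V(walk y [μ⁺,ν⁺,μ̄,ν̄]) = V₁V₂V₃⁻¹V₄⁻¹`, any `μ, ν`), ★`dist1_holAt_walk_plaq_lt_of_ne` (`PlaqSmall δ V`, `μ ≠ ν` ⟹ `dist1 V(walk y [μ⁺,ν⁺,μ̄,ν̄]) < δ`; the case
   `ν < μ` is the INVERSE of the positively oriented plaquette `(y; ν, μ)`), ★★`conj_covWalkSum_walk_plaq_LR_eq` — THE ONE-EDGE CONJUGATION IDENTITY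
   `V₁·Y_V(walk (y+e_μ) [ν⁺,μ̄,ν̄,μ⁺])[Z]·V₁⋆ = Y_V(walk y [μ⁺,ν⁺,μ̄,ν̄])[Z] − Z⟨y,μ⟩ + W·Z⟨y,μ⟩·W⋆` (`W = V₁V₂V₃⁻¹V₄⁻¹`), ★★`norm_covWalkSum_walk_plaq_LR_le` —
   `‖Y_V^{LR}‖ ≤ ‖Y_V^{LL}‖ + 2·dist1(W)·‖Z⟨y,μ⟩‖` (✓A `norm_coe_conj_le`, `norm_conj_sub_self_le`).
§2 ★`shiftN_shiftN_succ_eq_shift` (`x + (s+1)e_μ + t e_ν = (x + s e_μ + t e_ν) + e_μ`), ★★★`row_LL_SU2` — ✓E `norm_curl_chartRead_le_local_SU2` IN (K5)'s SHAPE for ONE step: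
   `‖Y_{Ū(U₀)}(walk y′ [μ⁺,ν⁺,μ̄,ν̄])[ψ̂_{U₀}(X)]‖ ≤ |I|⁻¹·Σ_{a} ‖Y_{U₀}(walk x_a [μ⁺,ν⁺,μ̄,ν̄])[X̂]‖ + S_E(M) + 2δ·L²·M` (`S_E(M)` = E's five source terms at the local size `M ≥ ‖X b‖` on the
   four corner blocks; the `2δL²M` is the LR→LL price: `|I|·L²` summands × `2δM`, × `|I|⁻¹`).
§3 ★★★`rows_LL_tower_SU2` — THE TOWER EDITION, (K5)'s row hypothesis LITERALLY for `ρ i x := ‖Y_{U i}(walk x [μ⁺,ν⁺,μ̄,ν̄])[X̂ i]‖` and the explicit `src`, given the tower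
   `U (i+1) = Ū(U i)`, `X (i+1) = ψ_{U i}(X i)` (`i < r`) and per-level guards `α_i ≤ 1∕24`, `α_i < δ_N`, `PlaqSmall δ_i (U i)`, `α^p_{i+1}`, local sizes `M (i+1) y′ ≥ ‖X i b‖` on the corner
   blocks — all HYPOTHESES (the (M,V)-profile typist discharges them; the knit only sees `σ_i ≥ src i` on the `|rel| ≤ 2` region, px16's SOURCE hypothesis).

HONEST.  Matrix bookkeeping and re-indexing over ✓E; nothing of Bałaban's analysis asserted; the guards, the θ-suppression of `M`, the composed kernel (K0)–(K5), the dock's instantiation,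
(★), (SCT′-c)₁₂₃, (LIFT-LAD′), (TOP-LAD′), (ST′), (ST), LOC, AVG₂♭-ax_q, GAP♯∘ (`stub_uniformFibreGapOrbit`, registry 3732b7df UNTOUCHED, 0∕5), the five REGISTERED stubs, S2β, crux 20520,
19936, 19200, `YM3TorusSU2` — NOT proved; rung R3 = SU(2) YM₃ on T³ — NOT d = 4, NOT infinite volume, NOT a mass gap, NOT Clay; the Yang–Mills mass gap is NOT proved.  Axioms standard.

References: [Balaban1985Averaging] CMP **98** (1985) (9) p.19, (19)–(20) p.21, Prop. 1 (51) p.26, (56)–(58) p.27, Prop. 3 (121)–(126) p.36; [Balaban1987RG1] CMP **109** (1987)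
(0.1)–(0.4), (0.8), (0.18) pp.251–255.
-/

set_option autoImplicit false

noncomputable section

open scoped Matrix.Norms.L2Operator BigOperators
open Finset

namespace Summit.QuantumFields.YangMills.Theorems.FluctuationComparisonRegPrIntLS2BetaCoarseCurlRowsLL

open Literature.MathematicalPhysics.QuantumFieldTheory.Balaban1983to89
open Literature.MathematicalPhysics.QuantumFieldTheory.Balaban1983to89.T4Continuum
open Literature.MathematicalPhysics.QuantumFieldTheory.Balaban1983to89.HaarExponentialChart
open Literature.MathematicalPhysics.QuantumFieldTheory.Balaban1983to89.HaarExponentialChart.IsChartRep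
open Literature.MathematicalPhysics.QuantumFieldTheory.Balaban1983to89.BlockAveraging (Idx avgFun loopHol off corr Small)
open Literature.MathematicalPhysics.QuantumFieldTheory.Balaban1983to89.ExpMeanLog (expMeanLogSU deltaSU)
open Literature.MathematicalPhysics.QuantumFieldTheory.Balaban1983to89.BlockAveragingEMLLinearised (stepFactor length_walk walkEnd_emb_stairWord_eq_blockSite)
open Literature.MathematicalPhysics.QuantumFieldTheory.Balaban1983to89.BlockAveragingEMLLinearisedBackground
  (covStep covWalkSum covWalkSum_nil covWalkSum_cons covWalkSum_append covWalkSum_add covLinAvgR0 norm_covWalkSum_le)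
open Literature.MathematicalPhysics.QuantumFieldTheory.Balaban1983to89.B10StarCount (shift_unshift unshift_shift)
open Literature.MathematicalPhysics.QuantumFieldTheory.Balaban1983to89.B10Eq47AxialChi (shiftN shiftN_succ shiftN_zero)
open Literature.MathematicalPhysics.QuantumFieldTheory.Balaban1983to89.BlockAveragingEMLProp2 (shift_shift_comm shiftN_apply walkEnd_replicate_true)
open Literature.MathematicalPhysics.QuantumFieldTheory.Balaban1983to89.Node00
open Summit.QuantumFields.YangMills.Theorems.FluctuationComparisonRegPrIntLS2BetaCovWalkSumStokes (norm_coe_conj_le norm_conj_sub_self_le)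
open Summit.QuantumFields.YangMills.Theorems.FluctuationComparisonRegPrIntLS2BetaCoarseCurlTransports (covWalkSum_walk_plaq_eq shift_shift_unshift)
open Summit.QuantumFields.YangMills.Theorems.FluctuationComparisonRegPrIntLS2BetaCoarseCurlLocal
  (unshift_shiftN_shiftN_succ walkEnd_stair_replicate_eq_shiftN blockOf_shiftN_shiftN_blockSite norm_curl_chartRead_le_local_SU2 norm_curl_chartRead_le_local)

variable {P : Params} {j : ℕ} {N : ℕ} [NeZero N]

/-! ## §1 The plaquette word from the lower-right corner vs from the lower-left corner: one-edge conjugation -/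

section OneEdge

omit [NeZero N] in
/-- ★ **THE HOLONOMY OF THE PLAQUETTE WORD** `[μ⁺, ν⁺, μ̄, ν̄]` from `y` is `V₁V₂V₃⁻¹V₄⁻¹` (`V₁ = V⟨y,μ⟩`, `V₂ = V⟨y+e_μ,ν⟩`, `V₃ = V⟨y+e_ν,μ⟩`, `V₄ = V⟨y,ν⟩`), for ANY `μ, ν`.
[cite: Balaban1985Averaging, (9) p.19] -/
theorem holAt_walk_plaq_eq_prod {G : Type*} [GaugeGroup G] {k : ℕ} (V : GaugeField P k G) (y : Site P k) (μ ν : Fin P.d) :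
    holAt V (walk y [((μ, true) : Letter P.d), (ν, true), (μ, false), (ν, false)]) =
      V ⟨y, μ⟩ * V ⟨y.shift μ, ν⟩ * (V ⟨y.shift ν, μ⟩)⁻¹ * (V ⟨y, ν⟩)⁻¹ := by
  simp only [walk, holAt_cons, holAt_nil, shift_shift_unshift, unshift_shift, Bool.false_eq_true, ↓reduceIte, mul_one, mul_assoc]

omit [NeZero N] in
/-- ★ **SMALL PLAQUETTES, EITHER ORIENTATION**: under `PlaqSmall δ V`, `dist1 V(walk y [μ⁺,ν⁺,μ̄,ν̄]) < δ` for every `μ ≠ ν` (for `ν < μ` the word is the inverse of the positively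
oriented plaquette `(y; ν, μ)` and `dist1` is inversion invariant). [cite: Balaban1987RG1, (0.18) p.255] -/
theorem dist1_holAt_walk_plaq_lt_of_ne {G : Type*} [GaugeGroup G] {k : ℕ} {V : GaugeField P k G} {δ : ℝ} (hV : PlaqSmall δ V) (y : Site P k) {μ ν : Fin P.d}
    (hμν : μ ≠ ν) : dist1 (holAt V (walk y [((μ, true) : Letter P.d), (ν, true), (μ, false), (ν, false)])) < δ := by
  -- positively oriented case: the word's holonomy IS `plaqHol`
  have hpos : ∀ {a b : Fin P.d} (hab : a < b), dist1 (holAt V (walk y [((a, true) : Letter P.d), (b, true), (a, false), (b, false)])) < δ := by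
    intro a b hab
    have e : holAt V (walk y [((a, true) : Letter P.d), (b, true), (a, false), (b, false)]) = GaugeField.plaqHol V ⟨y, a, b, hab⟩ := by
      rw [holAt_walk_plaq_eq_prod]; rfl
    rw [e]; exact hV _
  rcases lt_or_gt_of_ne hμν with h | h
  · exact hpos h
  · have hinv : holAt V (walk y [((μ, true) : Letter P.d), (ν, true), (μ, false), (ν, false)]) =
        (holAt V (walk y [((ν, true) : Letter P.d), (μ, true), (ν, false), (μ, false)]))⁻¹ := by
      rw [holAt_walk_plaq_eq_prod, holAt_walk_plaq_eq_prod]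
      simp only [mul_inv_rev, inv_inv, mul_assoc]
    rw [hinv, GaugeGroup.dist1_inv]
    exact hpos h

omit [NeZero N] in
/-- ★★ **THE ONE-EDGE CONJUGATION IDENTITY**: reading the plaquette from its lower-RIGHT corner `y + e_μ` by `[ν⁺, μ̄, ν̄, μ⁺]` and transporting back along the first edge gives the
lower-LEFT reading minus its first term plus that term transported around the whole plaquette:
`V₁·Y_V(walk (y+e_μ) [ν⁺,μ̄,ν̄,μ⁺])[Z]·V₁⋆ = Y_V(walk y [μ⁺,ν⁺,μ̄,ν̄])[Z] − Z⟨y,μ⟩ + W·Z⟨y,μ⟩·W⋆`, `W = V₁V₂V₃⁻¹V₄⁻¹`. [cite: Balaban1985Averaging, (58) p.27, (9) p.19] -/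
theorem conj_covWalkSum_walk_plaq_LR_eq {k : ℕ} (V : GaugeField P k (SU N)) (Z : PBond P k → Matrix (Fin N) (Fin N) ℂ) (y : Site P k) (μ ν : Fin P.d) :
    ((V ⟨y, μ⟩ : SU N) : Matrix (Fin N) (Fin N) ℂ) * covWalkSum V Z (walk (y.shift μ) [((ν, true) : Letter P.d), (μ, false), (ν, false), (μ, true)]) *
        star ((V ⟨y, μ⟩ : SU N) : Matrix (Fin N) (Fin N) ℂ) =
      covWalkSum V Z (walk y [((μ, true) : Letter P.d), (ν, true), (μ, false), (ν, false)]) - Z ⟨y, μ⟩ +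
        ((V ⟨y, μ⟩ * V ⟨y.shift μ, ν⟩ * (V ⟨y.shift ν, μ⟩)⁻¹ * (V ⟨y, ν⟩)⁻¹ : SU N) : Matrix (Fin N) (Fin N) ℂ) * Z ⟨y, μ⟩ *
          star ((V ⟨y, μ⟩ * V ⟨y.shift μ, ν⟩ * (V ⟨y.shift ν, μ⟩)⁻¹ * (V ⟨y, ν⟩)⁻¹ : SU N) : Matrix (Fin N) (Fin N) ℂ) := by
  have hVV : ∀ g : SU N, star ((g : SU N) : Matrix (Fin N) (Fin N) ℂ) * ((g : SU N) : Matrix (Fin N) (Fin N) ℂ) = 1 := fun g =>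
    Matrix.mem_unitaryGroup_iff'.mp g.2.1
  have hVV' : ∀ g : SU N, ((g : SU N) : Matrix (Fin N) (Fin N) ℂ) * star ((g : SU N) : Matrix (Fin N) (Fin N) ℂ) = 1 := fun g =>
    Matrix.mem_unitaryGroup_iff.mp g.2.1
  simp only [walk, covWalkSum_cons, covWalkSum_nil, covStep, stepFactor, shift_shift_unshift, unshift_shift, Bool.false_eq_true, ↓reduceIte,
    Submonoid.coe_mul, coe_inv_SU, star_mul, star_star, mul_zero, zero_mul, add_zero]
  have h1 := hVV (V ⟨y, μ⟩)
  have h2 := hVV' (V ⟨y, μ⟩)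
  have h3 := hVV (V ⟨y.shift ν, μ⟩)
  have h4 := hVV' (V ⟨y.shift ν, μ⟩)
  have h5 := hVV (V ⟨y, ν⟩)
  have h6 := hVV' (V ⟨y, ν⟩)
  noncomm_ring [h1, h2, h3, h4, h5, h6]

/-- `‖M‖ ≤ ‖g·M·g⋆‖` for `g ∈ SU(N)` (with ✓A `norm_coe_conj_le`: unitary conjugation is an isometry). [folklore] -/
theorem norm_le_norm_coe_conj (g : SU N) (M : Matrix (Fin N) (Fin N) ℂ) :
    ‖M‖ ≤ ‖(g : Matrix (Fin N) (Fin N) ℂ) * M * star (g : Matrix (Fin N) (Fin N) ℂ)‖ := by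
  have hVV : star (g : Matrix (Fin N) (Fin N) ℂ) * (g : Matrix (Fin N) (Fin N) ℂ) = 1 := Matrix.mem_unitaryGroup_iff'.mp g.2.1
  have e : ((g⁻¹ : SU N) : Matrix (Fin N) (Fin N) ℂ) * ((g : Matrix (Fin N) (Fin N) ℂ) * M * star (g : Matrix (Fin N) (Fin N) ℂ)) *
      star ((g⁻¹ : SU N) : Matrix (Fin N) (Fin N) ℂ) = M := by
    rw [coe_inv_SU, star_star]
    calc _ = (star (g : Matrix (Fin N) (Fin N) ℂ) * (g : Matrix (Fin N) (Fin N) ℂ)) * M * (star (g : Matrix (Fin N) (Fin N) ℂ) * (g : Matrix (Fin N) (Fin N) ℂ)) := by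
          noncomm_ring
      _ = M := by rw [hVV, one_mul, mul_one]
  calc ‖M‖ = ‖((g⁻¹ : SU N) : Matrix (Fin N) (Fin N) ℂ) * ((g : Matrix (Fin N) (Fin N) ℂ) * M * star (g : Matrix (Fin N) (Fin N) ℂ)) *
      star ((g⁻¹ : SU N) : Matrix (Fin N) (Fin N) ℂ)‖ := by rw [e]
    _ ≤ _ := norm_coe_conj_le _ _

/-- ★★ **THE LR→LL BOUND**: `‖Y_V(walk (y+e_μ) [ν⁺,μ̄,ν̄,μ⁺])[Z]‖ ≤ ‖Y_V(walk y [μ⁺,ν⁺,μ̄,ν̄])[Z]‖ + 2·dist1(V(walk y [μ⁺,ν⁺,μ̄,ν̄]))·‖Z⟨y,μ⟩‖` (unitary conjugation is an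
isometry; ✓A `norm_conj_sub_self_le`). [cite: Balaban1985Averaging, (58) p.27, (19)-(20) p.21] -/
theorem norm_covWalkSum_walk_plaq_LR_le {k : ℕ} (V : GaugeField P k (SU N)) (Z : PBond P k → Matrix (Fin N) (Fin N) ℂ) (y : Site P k) (μ ν : Fin P.d) :
    ‖covWalkSum V Z (walk (y.shift μ) [((ν, true) : Letter P.d), (μ, false), (ν, false), (μ, true)])‖ ≤
      ‖covWalkSum V Z (walk y [((μ, true) : Letter P.d), (ν, true), (μ, false), (ν, false)])‖ +
        2 * dist1 (holAt V (walk y [((μ, true) : Letter P.d), (ν, true), (μ, false), (ν, false)])) * ‖Z ⟨y, μ⟩‖ := by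
  have hconj := conj_covWalkSum_walk_plaq_LR_eq V Z y μ ν
  have hhol := holAt_walk_plaq_eq_prod V y μ ν
  calc ‖covWalkSum V Z (walk (y.shift μ) [((ν, true) : Letter P.d), (μ, false), (ν, false), (μ, true)])‖
      ≤ ‖((V ⟨y, μ⟩ : SU N) : Matrix (Fin N) (Fin N) ℂ) * covWalkSum V Z (walk (y.shift μ) [((ν, true) : Letter P.d), (μ, false), (ν, false), (μ, true)]) *
          star ((V ⟨y, μ⟩ : SU N) : Matrix (Fin N) (Fin N) ℂ)‖ := norm_le_norm_coe_conj _ _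
    _ = ‖covWalkSum V Z (walk y [((μ, true) : Letter P.d), (ν, true), (μ, false), (ν, false)]) - Z ⟨y, μ⟩ +
          ((V ⟨y, μ⟩ * V ⟨y.shift μ, ν⟩ * (V ⟨y.shift ν, μ⟩)⁻¹ * (V ⟨y, ν⟩)⁻¹ : SU N) : Matrix (Fin N) (Fin N) ℂ) * Z ⟨y, μ⟩ *
            star ((V ⟨y, μ⟩ * V ⟨y.shift μ, ν⟩ * (V ⟨y.shift ν, μ⟩)⁻¹ * (V ⟨y, ν⟩)⁻¹ : SU N) : Matrix (Fin N) (Fin N) ℂ)‖ := by rw [hconj]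
    _ = ‖covWalkSum V Z (walk y [((μ, true) : Letter P.d), (ν, true), (μ, false), (ν, false)]) +
          (((V ⟨y, μ⟩ * V ⟨y.shift μ, ν⟩ * (V ⟨y.shift ν, μ⟩)⁻¹ * (V ⟨y, ν⟩)⁻¹ : SU N) : Matrix (Fin N) (Fin N) ℂ) * Z ⟨y, μ⟩ *
            star ((V ⟨y, μ⟩ * V ⟨y.shift μ, ν⟩ * (V ⟨y.shift ν, μ⟩)⁻¹ * (V ⟨y, ν⟩)⁻¹ : SU N) : Matrix (Fin N) (Fin N) ℂ) - Z ⟨y, μ⟩)‖ := by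
        rw [sub_add_eq_add_sub, add_sub_assoc]
    _ ≤ ‖covWalkSum V Z (walk y [((μ, true) : Letter P.d), (ν, true), (μ, false), (ν, false)])‖ +
          ‖((V ⟨y, μ⟩ * V ⟨y.shift μ, ν⟩ * (V ⟨y.shift ν, μ⟩)⁻¹ * (V ⟨y, ν⟩)⁻¹ : SU N) : Matrix (Fin N) (Fin N) ℂ) * Z ⟨y, μ⟩ *
            star ((V ⟨y, μ⟩ * V ⟨y.shift μ, ν⟩ * (V ⟨y.shift ν, μ⟩)⁻¹ * (V ⟨y, ν⟩)⁻¹ : SU N) : Matrix (Fin N) (Fin N) ℂ) - Z ⟨y, μ⟩‖ := norm_add_le _ _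
    _ ≤ ‖covWalkSum V Z (walk y [((μ, true) : Letter P.d), (ν, true), (μ, false), (ν, false)])‖ +
          2 * dist1 (V ⟨y, μ⟩ * V ⟨y.shift μ, ν⟩ * (V ⟨y.shift ν, μ⟩)⁻¹ * (V ⟨y, ν⟩)⁻¹) * ‖Z ⟨y, μ⟩‖ :=
        add_le_add le_rfl (norm_conj_sub_self_le _ _)
    _ = _ := by rw [hhol]

end OneEdge


/-! ## §2 One step of the row inequality in the lower-left convention -/

section Row

/-- ★ `x + (s+1)e_μ + t e_ν = (x + s e_μ + t e_ν) + e_μ`: B2's lower-right base point is the lower-left one plus `e_μ`. [folklore] -/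
theorem shiftN_shiftN_succ_eq_shift {k : ℕ} (x : Site P k) (μ ν : Fin P.d) (s t : ℕ) :
    shiftN (shiftN x μ (s + 1)) ν t = (shiftN (shiftN x μ s) ν t).shift μ := by
  rw [← unshift_shiftN_shiftN_succ x μ ν s t, shift_unshift]

/-- ★★ **ONE SUMMAND, LR→LL**: B2's summand `(i, s, t)` (the plaquette read from `x_i + (s+1)e_μ + t e_ν` by `[ν⁺, μ̄, ν̄, μ⁺]`) is at most the same plaquette read from its lower-left
corner `x_i + s e_μ + t e_ν` by `[μ⁺, ν⁺, μ̄, ν̄]`, plus `2δ·M` (`PlaqSmall δ U₀`, `M ≥ ‖X b‖` on the four corner blocks; the first edge issues from a corner block, ✓E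
`blockOf_shiftN_shiftN_blockSite`). [cite: Balaban1985Averaging, (58) p.27, (19)-(20) p.21; Balaban1987RG1, (0.18) p.255] -/
theorem summand_LR_le_LL (hj : j + 1 ≤ P.m + P.K) (U₀ : GaugeField P j (SU N)) {δ : ℝ} (hδ : 0 ≤ δ) (hU : PlaqSmall δ U₀) (y : Site P (j + 1))
    {μ ν : Fin P.d} (hμν : μ ≠ ν) (X : PBond P j → (specialUnitaryLogChart (Fin N)).lie) {M : ℝ}
    (hXM : ∀ b : PBond P j, (blockOf b.src = y ∨ blockOf b.src = y.shift μ ∨ blockOf b.src = y.shift ν ∨ blockOf b.src = (y.shift μ).shift ν) → ‖X b‖ ≤ M)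
    (i : Idx P) {s t : ℕ} (hs : s < P.L) (ht : t < P.L) :
    ‖covWalkSum U₀ (fun b => ((X b : (specialUnitaryLogChart (Fin N)).lie) : Matrix (Fin N) (Fin N) ℂ))
        (walk (walkEnd (walkEnd (emb y) (stairWord i.2.1 (off i.1))) (List.replicate (s + 1) (μ, true) ++ List.replicate t (ν, true)))
        [((ν, true) : Letter P.d), (μ, false), (ν, false), (μ, true)])‖ ≤
      ‖covWalkSum U₀ (fun b => ((X b : (specialUnitaryLogChart (Fin N)).lie) : Matrix (Fin N) (Fin N) ℂ))
        (walk (shiftN (shiftN (Site.blockSite y i.1) μ s) ν t) [((μ, true) : Letter P.d), (ν, true), (μ, false), (ν, false)])‖ + 2 * δ * M := by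
  rw [walkEnd_stair_replicate_eq_shiftN, shiftN_shiftN_succ_eq_shift]
  have h1 := norm_covWalkSum_walk_plaq_LR_le U₀ (fun b => ((X b : (specialUnitaryLogChart (Fin N)).lie) : Matrix (Fin N) (Fin N) ℂ))
    (shiftN (shiftN (Site.blockSite y i.1) μ s) ν t) μ ν
  have hdist : dist1 (holAt U₀ (walk (shiftN (shiftN (Site.blockSite y i.1) μ s) ν t) [((μ, true) : Letter P.d), (ν, true), (μ, false), (ν, false)])) ≤ δ :=
    (dist1_holAt_walk_plaq_lt_of_ne hU _ hμν).le
  have hcorner := blockOf_shiftN_shiftN_blockSite hj y i.1 hμν hs.le ht.le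
  have hZ : ‖(fun b => ((X b : (specialUnitaryLogChart (Fin N)).lie) : Matrix (Fin N) (Fin N) ℂ)) ⟨shiftN (shiftN (Site.blockSite y i.1) μ s) ν t, μ⟩‖ ≤ M := by
    show ‖((X ⟨shiftN (shiftN (Site.blockSite y i.1) μ s) ν t, μ⟩ : (specialUnitaryLogChart (Fin N)).lie) : Matrix (Fin N) (Fin N) ℂ)‖ ≤ M
    rw [Submodule.norm_coe]
    exact hXM _ hcorner
  have h0 : 0 ≤ dist1 (holAt U₀ (walk (shiftN (shiftN (Site.blockSite y i.1) μ s) ν t) [((μ, true) : Letter P.d), (ν, true), (μ, false), (ν, false)])) :=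
    GaugeGroup.dist1_nonneg _
  have h2 : 2 * dist1 (holAt U₀ (walk (shiftN (shiftN (Site.blockSite y i.1) μ s) ν t) [((μ, true) : Letter P.d), (ν, true), (μ, false), (ν, false)])) *
      ‖(fun b => ((X b : (specialUnitaryLogChart (Fin N)).lie) : Matrix (Fin N) (Fin N) ℂ)) ⟨shiftN (shiftN (Site.blockSite y i.1) μ s) ν t, μ⟩‖ ≤ 2 * δ * M :=
    mul_le_mul (mul_le_mul_of_nonneg_left hdist (by norm_num)) hZ (norm_nonneg _) (by positivity)
  linarith

/-- ★ **RE-INDEXING**: B2's triple sum over `(i, s, t)` is the sum over the product Finset `I × (range L × range L)` of px16's index `a = (i, (s, t))`. [folklore] -/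
theorem sum_Idx_range_range_eq_sum_product (f : Idx P → ℕ → ℕ → ℝ) :
    ∑ i : Idx P, ∑ s ∈ Finset.range P.L, ∑ t ∈ Finset.range P.L, f i s t =
      ∑ a ∈ (Finset.univ : Finset (Idx P)) ×ˢ (Finset.range P.L ×ˢ Finset.range P.L), f a.1 a.2.1 a.2.2 := by
  rw [Finset.sum_product]
  refine Finset.sum_congr rfl fun i _ => ?_
  rw [Finset.sum_product]

/-- ★★★ **THE ROW IN THE LOWER-LEFT CONVENTION, `SU(2)`, ONE STEP**: ✓E `norm_curl_chartRead_le_local_SU2` with its dilution term re-read plaquette by plaquette from the lower-LEFT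
corners `x_a = blockSite y′ r_a + s_a e_μ + t_a e_ν` by the word `[μ⁺, ν⁺, μ̄, ν̄]` (px16 g23's (K5) row shape), at the price `2δ·L²·M` (`|I|·L²` summands, `2δM` each, `× |I|⁻¹`).
[cite: Balaban1985Averaging, Prop. 1 (51) p.26, Prop. 3 (121)-(126) p.36, (58) p.27; Balaban1987RG1, (0.4), (0.8), (0.18) pp.253-255] -/
theorem row_LL_SU2 (hj : j + 1 ≤ P.m + P.K) (U₀ : GaugeField P j (SU 2)) {α : ℝ} (hα : ∀ (c : PBond P (j + 1)) (i : Idx P), dist1 (loopHol U₀ c i) ≤ α)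
    (hα24 : α ≤ 1 / 24) (hαδ : α < deltaSU (Fin 2)) {δ : ℝ} (hδ : 0 ≤ δ) (hU : PlaqSmall δ U₀) (y : Site P (j + 1)) {μ ν : Fin P.d} (hμν : μ ≠ ν) {αp : ℝ}
    (hαp : dist1 (holAt (avgFun (expMeanLogSU (n := Fin 2)) U₀) (walk y [((μ, true) : Letter P.d), (ν, true), (μ, false), (ν, false)])) ≤ αp)
    (X : PBond P j → (specialUnitaryLogChart (Fin 2)).lie) {M : ℝ} (hM : 0 ≤ M)
    (hXM : ∀ b : PBond P j, (blockOf b.src = y ∨ blockOf b.src = y.shift μ ∨ blockOf b.src = y.shift ν ∨ blockOf b.src = (y.shift μ).shift ν) → ‖X b‖ ≤ M) :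
    ‖covWalkSum (avgFun (expMeanLogSU (n := Fin 2)) U₀)
        (fun c : PBond P (j + 1) => (((isChartRep_specialUnitaryGroup (n := Fin 2)).logChart
            (avgFun (expMeanLogSU (n := Fin 2)) (fun b => (isChartRep_specialUnitaryGroup (n := Fin 2)).expChart (X b) * U₀ b) c *
              (avgFun (expMeanLogSU (n := Fin 2)) U₀ c)⁻¹) : (specialUnitaryLogChart (Fin 2)).lie) : Matrix (Fin 2) (Fin 2) ℂ))
        (walk y [((μ, true) : Letter P.d), (ν, true), (μ, false), (ν, false)])‖ ≤
      (Fintype.card (Idx P) : ℝ)⁻¹ * ∑ a ∈ (Finset.univ : Finset (Idx P)) ×ˢ (Finset.range P.L ×ˢ Finset.range P.L),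
          ‖covWalkSum U₀ (fun b => ((X b : (specialUnitaryLogChart (Fin 2)).lie) : Matrix (Fin 2) (Fin 2) ℂ))
            (walk (shiftN (shiftN (Site.blockSite y a.1.1) μ a.2.1) ν a.2.2) [((μ, true) : Letter P.d), (ν, true), (μ, false), (ν, false)])‖ +
        ((P.L : ℝ) * ((P.L : ℝ) * (2 * δ * ((P.L : ℝ) + 2 * P.L + 2) * M)) + 48 * α * ((P.L : ℝ) * M) +
          (2 * αp * ((((P.d + 2) * P.L : ℕ) : ℝ) * M) + 24 * α * ((((P.d + 2) * P.L : ℕ) : ℝ) * M)) +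
          4 * (404 * (((P.d + 2) * P.L : ℕ) : ℝ) * α * M) + 4 * (4550400 * (((P.d + 2) * P.L : ℕ) : ℝ) ^ 2 * M ^ 2) +
          2 * δ * ((P.L : ℝ) ^ 2 * M)) := by
  have hE := norm_curl_chartRead_le_local_SU2 hj U₀ hα hα24 hαδ hδ hU y hμν hαp X hM hXM
  -- summand by summand
  have hsum : ∑ i : Idx P, ∑ s ∈ Finset.range P.L, ∑ t ∈ Finset.range P.L,
        ‖covWalkSum U₀ (fun b => ((X b : (specialUnitaryLogChart (Fin 2)).lie) : Matrix (Fin 2) (Fin 2) ℂ))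
          (walk (walkEnd (walkEnd (emb y) (stairWord i.2.1 (off i.1))) (List.replicate (s + 1) (μ, true) ++ List.replicate t (ν, true)))
          [((ν, true) : Letter P.d), (μ, false), (ν, false), (μ, true)])‖ ≤
      ∑ i : Idx P, ∑ s ∈ Finset.range P.L, ∑ t ∈ Finset.range P.L,
        (‖covWalkSum U₀ (fun b => ((X b : (specialUnitaryLogChart (Fin 2)).lie) : Matrix (Fin 2) (Fin 2) ℂ))
          (walk (shiftN (shiftN (Site.blockSite y i.1) μ s) ν t) [((μ, true) : Letter P.d), (ν, true), (μ, false), (ν, false)])‖ + 2 * δ * M) := by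
    refine Finset.sum_le_sum fun i _ => Finset.sum_le_sum fun s hs => Finset.sum_le_sum fun t ht => ?_
    exact summand_LR_le_LL hj U₀ hδ hU y hμν X hXM i (Finset.mem_range.1 hs) (Finset.mem_range.1 ht)
  -- the constant part of the summands
  have hconst : ∑ i : Idx P, ∑ s ∈ Finset.range P.L, ∑ t ∈ Finset.range P.L,
        (‖covWalkSum U₀ (fun b => ((X b : (specialUnitaryLogChart (Fin 2)).lie) : Matrix (Fin 2) (Fin 2) ℂ))
          (walk (shiftN (shiftN (Site.blockSite y i.1) μ s) ν t) [((μ, true) : Letter P.d), (ν, true), (μ, false), (ν, false)])‖ + 2 * δ * M) =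
      ∑ a ∈ (Finset.univ : Finset (Idx P)) ×ˢ (Finset.range P.L ×ˢ Finset.range P.L),
          ‖covWalkSum U₀ (fun b => ((X b : (specialUnitaryLogChart (Fin 2)).lie) : Matrix (Fin 2) (Fin 2) ℂ))
            (walk (shiftN (shiftN (Site.blockSite y a.1.1) μ a.2.1) ν a.2.2) [((μ, true) : Letter P.d), (ν, true), (μ, false), (ν, false)])‖ +
        (Fintype.card (Idx P) : ℝ) * ((P.L : ℝ) ^ 2 * (2 * δ * M)) := by
    rw [← sum_Idx_range_range_eq_sum_product (fun i s t =>
      ‖covWalkSum U₀ (fun b => ((X b : (specialUnitaryLogChart (Fin 2)).lie) : Matrix (Fin 2) (Fin 2) ℂ))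
        (walk (shiftN (shiftN (Site.blockSite y i.1) μ s) ν t) [((μ, true) : Letter P.d), (ν, true), (μ, false), (ν, false)])‖)]
    simp only [Finset.sum_add_distrib, Finset.sum_const, Finset.card_range, Finset.card_univ, nsmul_eq_mul]
    ring
  have hcard : (Fintype.card (Idx P) : ℝ)⁻¹ * ((Fintype.card (Idx P) : ℝ) * ((P.L : ℝ) ^ 2 * (2 * δ * M))) = 2 * δ * ((P.L : ℝ) ^ 2 * M) := by
    have hc : (Fintype.card (Idx P) : ℝ) ≠ 0 := Nat.cast_ne_zero.mpr Fintype.card_ne_zero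
    field_simp
  have hinv : 0 ≤ (Fintype.card (Idx P) : ℝ)⁻¹ := inv_nonneg.mpr (Nat.cast_nonneg _)
  have hmul := mul_le_mul_of_nonneg_left (hsum.trans_eq hconst) hinv
  rw [mul_add, hcard] at hmul
  linarith

end Row


/-! ## §3 The tower edition: (K5)'s row hypothesis for the descended pair -/

section Tower

/-- ★★★ **THE ROWS IN SHAPE — TOWER EDITION, `SU(2)`**: for a tower `U (i+1) = Ū(U i)`, `X (i+1) = ψ_{U i}(X i)` (`i < r ≤ m + K`) with per-step guards INDEXED BY THE COARSE LEVEL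
`i+1` (loop `α_{i+1} ≤ 1∕24`, `α_{i+1} < δ₂` for the loops of `U i`; `PlaqSmall δ_{i+1} (U i)`; coarse plaquettes `α^p_{i+1}`) and local sizes `M (i+1) y′ ≥ ‖X i b‖` on the four corner
blocks of `(y′; μ, ν)`, the relative-curl sizes `ρ i x := ‖Y_{U i}(walk x [μ⁺,ν⁺,μ̄,ν̄])[X̂ i]‖` satisfy px16 g23's (K5) ROW HYPOTHESIS (instantiate `ρ := fun i x => ‖…‖` and
`src := fun i y => L·L·2δ_i(3L+2)·M i y + 48α_i·L·M i y + (2α^p_i + 24α_i)·ℓ·M i y + 4·404·ℓ·α_i·M i y + 4·4550400·ℓ²·(M i y)² + 2δ_i·L²·M i y`, `ℓ = (d+2)L`; the two sides then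
agree by `rfl`). [cite: Balaban1985Averaging, Prop. 1 (51) p.26, Prop. 3 (121)-(126) p.36, Prop. 4 (128)-(135) pp.37-38; Balaban1987RG1, (0.4), (0.8), (0.18) pp.253-255] -/
theorem rows_LL_tower_SU2 {μ ν : Fin P.d} (hμν : μ ≠ ν) (r : ℕ) (hr : r ≤ P.m + P.K)
    (U : (i : ℕ) → GaugeField P i (SU 2)) (X : (i : ℕ) → PBond P i → (specialUnitaryLogChart (Fin 2)).lie)
    (hU : ∀ i, i < r → U (i + 1) = avgFun (expMeanLogSU (n := Fin 2)) (U i))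
    (hX : ∀ i, i < r → X (i + 1) = fun c : PBond P (i + 1) => (isChartRep_specialUnitaryGroup (n := Fin 2)).logChart
        (avgFun (expMeanLogSU (n := Fin 2)) (fun b => (isChartRep_specialUnitaryGroup (n := Fin 2)).expChart (X i b) * U i b) c *
          (avgFun (expMeanLogSU (n := Fin 2)) (U i) c)⁻¹))
    (α δ αp : ℕ → ℝ)
    (hα : ∀ i, i < r → ∀ (c : PBond P (i + 1)) (ι : Idx P), dist1 (loopHol (U i) c ι) ≤ α (i + 1))
    (hα24 : ∀ i, i < r → α (i + 1) ≤ 1 / 24) (hαδ : ∀ i, i < r → α (i + 1) < deltaSU (Fin 2))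
    (hδ : ∀ i, i < r → 0 ≤ δ (i + 1)) (hUs : ∀ i, i < r → PlaqSmall (δ (i + 1)) (U i))
    (hαp : ∀ i, i < r → ∀ y' : Site P (i + 1),
      dist1 (holAt (avgFun (expMeanLogSU (n := Fin 2)) (U i)) (walk y' [((μ, true) : Letter P.d), (ν, true), (μ, false), (ν, false)])) ≤ αp (i + 1))
    (M : (i : ℕ) → Site P i → ℝ) (hM : ∀ i, i < r → ∀ y' : Site P (i + 1), 0 ≤ M (i + 1) y')
    (hXM : ∀ i, i < r → ∀ (y' : Site P (i + 1)) (b : PBond P i),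
      (blockOf b.src = y' ∨ blockOf b.src = y'.shift μ ∨ blockOf b.src = y'.shift ν ∨ blockOf b.src = (y'.shift μ).shift ν) → ‖X i b‖ ≤ M (i + 1) y') :
    ∀ i, i < r → ∀ y' : Site P (i + 1),
      ‖covWalkSum (U (i + 1)) (fun c => ((X (i + 1) c : (specialUnitaryLogChart (Fin 2)).lie) : Matrix (Fin 2) (Fin 2) ℂ))
          (walk y' [((μ, true) : Letter P.d), (ν, true), (μ, false), (ν, false)])‖ ≤
        (Fintype.card (Idx P) : ℝ)⁻¹ * ∑ a ∈ (Finset.univ : Finset (Idx P)) ×ˢ (Finset.range P.L ×ˢ Finset.range P.L),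
            ‖covWalkSum (U i) (fun b => ((X i b : (specialUnitaryLogChart (Fin 2)).lie) : Matrix (Fin 2) (Fin 2) ℂ))
              (walk (shiftN (shiftN (Site.blockSite y' a.1.1) μ a.2.1) ν a.2.2) [((μ, true) : Letter P.d), (ν, true), (μ, false), (ν, false)])‖ +
          ((P.L : ℝ) * ((P.L : ℝ) * (2 * δ (i + 1) * ((P.L : ℝ) + 2 * P.L + 2) * M (i + 1) y')) + 48 * α (i + 1) * ((P.L : ℝ) * M (i + 1) y') +
            (2 * αp (i + 1) * ((((P.d + 2) * P.L : ℕ) : ℝ) * M (i + 1) y') + 24 * α (i + 1) * ((((P.d + 2) * P.L : ℕ) : ℝ) * M (i + 1) y')) +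
            4 * (404 * (((P.d + 2) * P.L : ℕ) : ℝ) * α (i + 1) * M (i + 1) y') + 4 * (4550400 * (((P.d + 2) * P.L : ℕ) : ℝ) ^ 2 * M (i + 1) y' ^ 2) +
            2 * δ (i + 1) * ((P.L : ℝ) ^ 2 * M (i + 1) y')) := by
  intro i hi y'
  rw [hU i hi, hX i hi]
  exact row_LL_SU2 (by omega) (U i) (hα i hi) (hα24 i hi) (hαδ i hi) (hδ i hi) (hUs i hi) y' hμν (hαp i hi y') (X i) (hM i hi y') (hXM i hi y')

/-- ★★ **THE SAME, PACKAGED AS (K5)'s BINDERS**: with `ρ` and `src` the two displayed lambdas, the row hypothesis of px16 g23's `exists_composedKernel` holds verbatim.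
[cite: Balaban1985Averaging, Prop. 4 (128)-(135) pp.37-38] -/
theorem rows_LL_tower_SU2_K5 {μ ν : Fin P.d} (hμν : μ ≠ ν) (r : ℕ) (hr : r ≤ P.m + P.K)
    (U : (i : ℕ) → GaugeField P i (SU 2)) (X : (i : ℕ) → PBond P i → (specialUnitaryLogChart (Fin 2)).lie)
    (hU : ∀ i, i < r → U (i + 1) = avgFun (expMeanLogSU (n := Fin 2)) (U i))
    (hX : ∀ i, i < r → X (i + 1) = fun c : PBond P (i + 1) => (isChartRep_specialUnitaryGroup (n := Fin 2)).logChart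
        (avgFun (expMeanLogSU (n := Fin 2)) (fun b => (isChartRep_specialUnitaryGroup (n := Fin 2)).expChart (X i b) * U i b) c *
          (avgFun (expMeanLogSU (n := Fin 2)) (U i) c)⁻¹))
    (α δ αp : ℕ → ℝ)
    (hα : ∀ i, i < r → ∀ (c : PBond P (i + 1)) (ι : Idx P), dist1 (loopHol (U i) c ι) ≤ α (i + 1))
    (hα24 : ∀ i, i < r → α (i + 1) ≤ 1 / 24) (hαδ : ∀ i, i < r → α (i + 1) < deltaSU (Fin 2))
    (hδ : ∀ i, i < r → 0 ≤ δ (i + 1)) (hUs : ∀ i, i < r → PlaqSmall (δ (i + 1)) (U i))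
    (hαp : ∀ i, i < r → ∀ y' : Site P (i + 1),
      dist1 (holAt (avgFun (expMeanLogSU (n := Fin 2)) (U i)) (walk y' [((μ, true) : Letter P.d), (ν, true), (μ, false), (ν, false)])) ≤ αp (i + 1))
    (M : (i : ℕ) → Site P i → ℝ) (hM : ∀ i, i < r → ∀ y' : Site P (i + 1), 0 ≤ M (i + 1) y')
    (hXM : ∀ i, i < r → ∀ (y' : Site P (i + 1)) (b : PBond P i),
      (blockOf b.src = y' ∨ blockOf b.src = y'.shift μ ∨ blockOf b.src = y'.shift ν ∨ blockOf b.src = (y'.shift μ).shift ν) → ‖X i b‖ ≤ M (i + 1) y')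
    (ρ src : (i : ℕ) → Site P i → ℝ)
    (hρ : ρ = fun i x => ‖covWalkSum (U i) (fun b => ((X i b : (specialUnitaryLogChart (Fin 2)).lie) : Matrix (Fin 2) (Fin 2) ℂ))
      (walk x [((μ, true) : Letter P.d), (ν, true), (μ, false), (ν, false)])‖)
    (hsrc : src = fun i x => (P.L : ℝ) * ((P.L : ℝ) * (2 * δ i * ((P.L : ℝ) + 2 * P.L + 2) * M i x)) + 48 * α i * ((P.L : ℝ) * M i x) +
            (2 * αp i * ((((P.d + 2) * P.L : ℕ) : ℝ) * M i x) + 24 * α i * ((((P.d + 2) * P.L : ℕ) : ℝ) * M i x)) +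
            4 * (404 * (((P.d + 2) * P.L : ℕ) : ℝ) * α i * M i x) + 4 * (4550400 * (((P.d + 2) * P.L : ℕ) : ℝ) ^ 2 * M i x ^ 2) +
            2 * δ i * ((P.L : ℝ) ^ 2 * M i x)) :
    ∀ i, i < r → ∀ y' : Site P (i + 1),
      ρ (i + 1) y' ≤ (Fintype.card (Idx P) : ℝ)⁻¹ *
          ∑ a ∈ (Finset.univ : Finset (Idx P)) ×ˢ (Finset.range P.L ×ˢ Finset.range P.L), ρ i (shiftN (shiftN (Site.blockSite y' a.1.1) μ a.2.1) ν a.2.2) +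
        src (i + 1) y' := by
  subst hρ hsrc
  exact rows_LL_tower_SU2 hμν r hr U X hU hX α δ αp hα hα24 hαδ hδ hUs hαp M hM hXM

end Tower


end Summit.QuantumFields.YangMills.Theorems.FluctuationComparisonRegPrIntLS2BetaCoarseCurlRowsLL

end
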